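import Summits.CriticalPhenomena.PercolationContinuityZ3.Theorems.PercNearOneGluingNoHeavyLowerTailSunflowerBernsteinPentagonCheck
import HarnessLib

/-!
# `NoHeavyLowerTail` (crux stmt-CriticalPhenomena-4575), abstract sunflower cubic: THE PENTAGON CORE `C₅` — COMPILED BERNSTEIN CERTIFICATES (B)

Support file (seat `prim-ineq-prove-1` gen 38; `--supports stmt-CriticalPhenomena-4575`; `--computational`: one `native_decide`
evaluation of the Boolean certificate `Bern.certifyA`, nothing else).  No `sorry`, no named facts.
Memo: run/shared/lean/prim/prim-ineq-prove-1/FINDING-BERNSTEIN-prove1-g38.md §1–§2.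

Continuation of …SunflowerBernsteinPentagonCheck (which defines the transversal indexing `Pentagon.C`): the certificates for
THREE nonempty pairwise disjoint sub-families of the five minimal transversals of the pentagon core, codes sorted by minima.
-/

namespace Summit.CriticalPhenomena.PercolationContinuityZ3.Theorems.SunflowerPartition

namespace SafeCalc

namespace Pentagon

open Finset Bern

/-- Certificates for three nonempty pairwise disjoint sub-families (codes sorted by minima). [this work] -/
theorem chk3 :
    ∀ u0 : Finset (Fin 5), u0.Nonempty →
    ∀ u1 : Finset (Fin 5), u1.Nonempty → Disjoint u0 u1 → u0.min < u1.min →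
    ∀ u2 : Finset (Fin 5), u2.Nonempty → Disjoint u0 u2 → Disjoint u1 u2 → u1.min < u2.min →
    certifyA 5 3 (safetyArr C 2 ![u0, u1, u2]) = true := by
  native_decide

end Pentagon

end SafeCalc

end Summit.CriticalPhenomena.PercolationContinuityZ3.Theorems.SunflowerPartition
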